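import Literature.Topology.FourManifolds.SphereFourGenusOneSplitting
import Literature.Topology.FourManifolds.SimplifiedBrokenLefschetzSidesGenus
import Literature.Topology.FourManifolds.SimplifiedBrokenLefschetzRoundCritical
import Literature.Topology.FourManifolds.RegularDomainMaps
import Literature.Geometry.Manifold.SmoothEmbeddingInverse
import Mathlib.Analysis.SpecialFunctions.Sqrt
import HarnessLib

/-!
# The sphere-side tube of a genus-one simplified broken Lefschetz fibration is the equatorial
# tube `S² × D²` of the 4-sphere; reduction of Baykur–Kamada's Lemma 11 (simply connected case)
# to Laudenbach–Poénaru and the polar handlebody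

Topic `Literature/Topology/FourManifolds`; brick for the named fact
`Literature.Topology.FourManifolds.nonempty_diffeomorph_sphere_four_of_sblf_genus_one_noLefschetz`
(Baykur–Kamada 2015, Lemma 11 with Cor. 14).  Everything in this file is **proved**; the `def`s
are explicit maps; no named fact is introduced.

Baykur–Kamada (2015), §2 and §5: the total space of a genus-one SBLF without Lefschetz points
splits as `X = X_l ∪ (W ∪ X_h)` with *lower side* `X_l ≅ S² × D²`; Auroux–Donaldson–Katzarkov
(2005), §8.2, Example 1: *"`X_+ ≃ S² × D²` lying over the northern hemisphere `D_+`"* and, in the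
simply connected case, *"`X_- ∪ W ≃ S¹ × B³`, and by gluing `X_+ = D² × S²` along the boundary we
obtain `X' ≃ S⁴`"*.  Here the first identification is made precise as a diffeomorphism of compact
`4`-manifolds with boundary onto the model tube of `SphereFourGenusOneSplitting.lean`, and the
whole fact is reduced to the Laudenbach–Poénaru extension theorem and the second identification
(in Morse-theoretic form).

* §1 **The model parametrisation** `Π : S² × ℝ² → S`, `Π(θ, w) = (θ, √2 w)/√(1 + 2|w|²)`, of the
  level sphere `S = {Σ xᵢ² = 1} ⊆ ℝ⁵` minus the polar circle, smooth, with tube function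
  `u(Π(θ, w)) = 2|w|²/(1 + 2|w|²)`; so `Π` carries `S² × {|w|² ≤ 1/2}` onto the equatorial tube
  `W₀ = {u ≤ 1/2}` (`SphereFourSplitting.EquatorTube`).
* §2 **The inverse parametrisation** `x ↦ (θ(x), w(x)) = (x₀₁₂/r, x₃₄/(√2 r))`, `r = √(1 - u)`,
  on `W₀`, smooth (`r > 0` there), with `Π ∘ (θ, w) = id` and `(θ, w) ∘ Π = id`.
* §3 **The sphere-side tube.**  For a genus-one Lefschetz-free SBLF `f : X → S²` on a closed
  `X : Type` with equatorial round image
  (`IsSimplifiedBrokenLefschetzFibration.exists_pole_isRegularLevel_nonempty_diffeomorph_equatorTube`):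
  with the pole `v` and the fibrewise product structure `ι : S² × ℝ² ↪ X` of the sphere side
  (`exists_pole_isSmoothEmbedding_sphere_two_prod_side`, along which the height `⟪v, f⟫` is
  `-1/(1 + 2|w|²)` in the coordinate `w`), every negative level `≠ -1` of the height
  `x ↦ ⟪v, f x⟫` is regular (`isRegularLevel_height_comp`), and **the closed sphere-side tube
  `B = {⟪v, f⟫ ≤ -1/2}` is diffeomorphic to `W₀`** (`SphereSideTube.tubeDiffeomorph`) by
  `ι (θ, w) ↦ Π (θ, w)`; smoothness into the regular domains by
  `HalfSliceAtlas.contMDiff_codRestrict`, Lee 2013, Cor. 5.30, and of `ι⁻¹` by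
  `Literature.Geometry.Manifold.contMDiffOn_invFun_range`, Lee 2013, Prop. 4.22.
* §4 **Reduction** (`nonempty_diffeomorph_sphere_four_of_sblf_genus_one_noLefschetz_of_laudenbachPoenaru_of_polarHandlebody`):
  the named fact follows from the Laudenbach–Poénaru fact `exists_diffeomorph_comp_incl_eq` and
  the statement — spelled out as a hypothesis, NOT vendored — that for every such fibration on a
  simply connected `X` the complementary tube `{⟪v, f⟫ ≥ -1/2}` (Auroux–Donaldson–Katzarkov's
  `X_- ∪ W`, Baykur–Kamada's `W ∪ X_h`) has a handle decomposition with one `0`-handle and one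
  `1`-handle: normalise the round image (`exists_image_round_eq_sphereEquator`), split `X` along
  the level (`RegularSublevel.isBoundaryGluing_split`), identify the sphere-side tube with `W₀`
  (§3) and apply
  `SphereFourSplitting.nonempty_diffeomorph_sphere_four_of_isBoundaryGluing_of_diffeomorph_equatorTube`.

## References

* R. İ. Baykur, S. Kamada, *Classification of broken Lefschetz fibrations with small fiber
  genera*, J. Math. Soc. Japan 67 (2015), §2, §5, Lemma 11, Cor. 14. [BaykurKamada2015]
* D. Auroux, S. K. Donaldson, L. Katzarkov, *Singular Lefschetz pencils*, Geom. Topol. 9 (2005),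
  §8.2, Example 1. [AurouxDonaldsonKatzarkov2005]
* F. Laudenbach, V. Poénaru, *A note on 4-dimensional handlebodies*, Bull. SMF 100 (1972).
  [LaudenbachPoenaruBSMF1972]
* J. M. Lee, *Introduction to Smooth Manifolds* (2013), Cor. 5.30, Prop. 4.22.
  [LeeSmoothManifolds2013]
* J. Milnor, *Morse theory* (1963), Thm. 3.1. [Milnor1963]
-/

open scoped Manifold ContDiff Topology RealInnerProductSpace
open Set Function Filter Metric Module
open Literature.AlgebraicTopology.SingularHomology

noncomputable section

namespace Literature.Topology.FourManifolds

/-- Local notation: `𝔼 n` is the model Euclidean space `EuclideanSpace ℝ (Fin n)`. -/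
local notation "𝔼 " n:arg => EuclideanSpace ℝ (Fin n)

/-- Local notation: `𝕊 n` is the unit sphere in `EuclideanSpace ℝ (Fin (n + 1))`. -/
local notation "𝕊 " n:arg => (Metric.sphere (0 : EuclideanSpace ℝ (Fin (n + 1))) 1)

attribute [local instance] fact_finrank_euclideanSpace_succ

namespace SphereFourSplitting

/-! ### §1 The model parametrisation of the level sphere minus the polar circle by `S² × ℝ²` -/

/-- **Smooth maps into `ℝᵏ` from smooth coordinates**: a map into `EuclideanSpace ℝ (Fin k)` all
of whose coordinate functions are `Cⁿ` is `Cⁿ` (through the continuous linear isomorphism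
`EuclideanSpace.equiv` with the `Π`-type and `contMDiff_pi_space`). [folklore] -/
theorem contMDiff_euclidean_of_coord {E' H' : Type*} [NormedAddCommGroup E'] [NormedSpace ℝ E']
    [TopologicalSpace H'] {J : ModelWithCorners ℝ E' H'} {N : Type*} [TopologicalSpace N]
    [ChartedSpace H' N] {k : ℕ} {n : WithTop ℕ∞} {φ : N → 𝔼 k}
    (h : ∀ i, ContMDiff J 𝓘(ℝ, ℝ) n fun x => φ x i) : ContMDiff J 𝓘(ℝ, 𝔼 k) n φ := by
  have h1 : ContMDiff J 𝓘(ℝ, Fin k → ℝ) n fun x i => φ x i := contMDiff_pi_space.2 h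
  have h2 := (EuclideanSpace.equiv (Fin k) ℝ).symm.contDiff.comp_contMDiff h1
  exact h2

/-- The square norm `|w|² = w₀² + w₁²` on `ℝ²`, in coordinates. [folklore] -/
def sq2 (w : 𝔼 2) : ℝ := w 0 ^ 2 + w 1 ^ 2

/-- `|w|² ≥ 0`. [folklore] -/
theorem sq2_nonneg (w : 𝔼 2) : 0 ≤ sq2 w := by unfold sq2; positivity

/-- `sq2 w = ‖w‖²`. [folklore] -/
theorem sq2_eq_norm_sq (w : 𝔼 2) : sq2 w = ‖w‖ ^ 2 := by
  rw [EuclideanSpace.norm_sq_eq, Fin.sum_univ_two]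
  simp [Real.norm_eq_abs, sq_abs, sq2]

/-- `sq2` is smooth. [folklore] -/
theorem contDiff_sq2 : ContDiff ℝ ∞ sq2 := by unfold sq2; fun_prop

/-- **The scale factor** `c(w) = 1/√(1 + 2|w|²)`. [folklore] -/
def scale (w : 𝔼 2) : ℝ := (√(1 + 2 * sq2 w))⁻¹

/-- `1 + 2|w|² > 0`. [folklore] -/
theorem one_add_two_mul_sq2_pos (w : 𝔼 2) : 0 < 1 + 2 * sq2 w := by
  have := sq2_nonneg w; linarith

/-- `c(w) > 0`. [folklore] -/
theorem scale_pos (w : 𝔼 2) : 0 < scale w :=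
  inv_pos.2 (Real.sqrt_pos.2 (one_add_two_mul_sq2_pos w))

/-- `c(w)² = 1/(1 + 2|w|²)`, i.e. `c² (1 + 2|w|²) = 1`. [folklore] -/
theorem scale_sq_mul (w : 𝔼 2) : scale w ^ 2 * (1 + 2 * sq2 w) = 1 := by
  rw [scale, inv_pow, Real.sq_sqrt (one_add_two_mul_sq2_pos w).le,
    inv_mul_cancel₀ (one_add_two_mul_sq2_pos w).ne']

/-- The scale factor is smooth. [folklore] -/
theorem contDiff_scale : ContDiff ℝ ∞ scale := by
  unfold scale
  refine ContDiff.inv (ContDiff.sqrt (contDiff_const.add (contDiff_const.mul contDiff_sq2))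
    fun w => (one_add_two_mul_sq2_pos w).ne') fun w => ?_
  exact (Real.sqrt_pos.2 (one_add_two_mul_sq2_pos w)).ne'

/-- **The model parametrisation** `Π(θ, w) = (c θ₀, c θ₁, c θ₂, √2 c w₀, √2 c w₁)`,
`c = 1/√(1 + 2|w|²)`, of the level sphere by `S² × ℝ²`. [folklore] -/
def tubeParam (p : (𝕊 2) × 𝔼 2) : 𝔼 5 :=
  (EuclideanSpace.equiv (Fin 5) ℝ).symm
    ![scale p.2 * (p.1 : 𝔼 3) 0, scale p.2 * (p.1 : 𝔼 3) 1, scale p.2 * (p.1 : 𝔼 3) 2,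
      √2 * scale p.2 * p.2 0, √2 * scale p.2 * p.2 1]

/-- Coordinates of `Π(θ, w)`. [folklore] -/
@[simp] theorem tubeParam_apply_zero (p : (𝕊 2) × 𝔼 2) : tubeParam p 0 = scale p.2 * (p.1 : 𝔼 3) 0 := rfl
/-- Coordinates of `Π(θ, w)`. [folklore] -/
@[simp] theorem tubeParam_apply_one (p : (𝕊 2) × 𝔼 2) : tubeParam p 1 = scale p.2 * (p.1 : 𝔼 3) 1 := rfl
/-- Coordinates of `Π(θ, w)`. [folklore] -/
@[simp] theorem tubeParam_apply_two (p : (𝕊 2) × 𝔼 2) : tubeParam p 2 = scale p.2 * (p.1 : 𝔼 3) 2 := rfl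
/-- Coordinates of `Π(θ, w)`. [folklore] -/
@[simp] theorem tubeParam_apply_three (p : (𝕊 2) × 𝔼 2) : tubeParam p 3 = √2 * scale p.2 * p.2 0 := rfl
/-- Coordinates of `Π(θ, w)`. [folklore] -/
@[simp] theorem tubeParam_apply_four (p : (𝕊 2) × 𝔼 2) : tubeParam p 4 = √2 * scale p.2 * p.2 1 := rfl

/-- A point of `S²` has `θ₀² + θ₁² + θ₂² = 1`. [folklore] -/
theorem sum_sq_sphereTwo (θ : 𝕊 2) : (θ : 𝔼 3) 0 ^ 2 + (θ : 𝔼 3) 1 ^ 2 + (θ : 𝔼 3) 2 ^ 2 = 1 := by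
  have h : ‖(θ : 𝔼 3)‖ = 1 := norm_eq_of_mem_sphere θ
  have h2 : ‖(θ : 𝔼 3)‖ ^ 2 = (θ : 𝔼 3) 0 ^ 2 + (θ : 𝔼 3) 1 ^ 2 + (θ : 𝔼 3) 2 ^ 2 := by
    rw [EuclideanSpace.norm_sq_eq, Fin.sum_univ_three]
    simp [Real.norm_eq_abs, sq_abs]
  rw [← h2, h, one_pow]

/-- **`Π` lands on the level sphere**: `N(Π(θ, w)) = c²(1 + 2|w|²) = 1`. [folklore] -/
theorem sqNorm_tubeParam (p : (𝕊 2) × 𝔼 2) : sqNorm (tubeParam p) = 1 := by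
  have hθ := sum_sq_sphereTwo p.1
  have hc := scale_sq_mul p.2
  have h2 : (√2 : ℝ) ^ 2 = 2 := Real.sq_sqrt zero_le_two
  simp only [sqNorm, tubeParam_apply_zero, tubeParam_apply_one, tubeParam_apply_two,
    tubeParam_apply_three, tubeParam_apply_four]
  simp only [sq2] at hc
  nlinarith [hθ, hc, h2]

/-- **The tube function along `Π`**: `u(Π(θ, w)) = 2 c² |w|²`. [folklore] -/
theorem tubeFn_tubeParam (p : (𝕊 2) × 𝔼 2) : tubeFn (tubeParam p) = 2 * scale p.2 ^ 2 * sq2 p.2 := by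
  have h2 : (√2 : ℝ) ^ 2 = 2 := Real.sq_sqrt zero_le_two
  simp only [tubeFn, tubeParam_apply_three, tubeParam_apply_four, sq2]
  nlinarith [h2]

/-- `u(Π(θ, w)) ≤ 1/2` iff `|w|² ≤ 1/2`. [folklore] -/
theorem tubeFn_tubeParam_le_half_iff (p : (𝕊 2) × 𝔼 2) :
    tubeFn (tubeParam p) ≤ 1 / 2 ↔ sq2 p.2 ≤ 1 / 2 := by
  rw [tubeFn_tubeParam]
  have hc := scale_sq_mul p.2
  have hcpos : 0 < scale p.2 ^ 2 := pow_pos (scale_pos p.2) 2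
  have hs := sq2_nonneg p.2
  constructor
  · intro h; nlinarith
  · intro h; nlinarith

/-- `1 - u(Π(θ, w)) = c²`. [folklore] -/
theorem one_sub_tubeFn_tubeParam (p : (𝕊 2) × 𝔼 2) : 1 - tubeFn (tubeParam p) = scale p.2 ^ 2 := by
  rw [tubeFn_tubeParam]
  have hc := scale_sq_mul p.2
  nlinarith

/-- **`Π` is smooth** (coordinatewise: products of the smooth scale factor with coordinates of
`θ ∈ S² ⊆ ℝ³` and of `w`). [folklore] -/
theorem contMDiff_tubeParam : ContMDiff ((𝓡 2).prod (𝓡 2)) 𝓘(ℝ, 𝔼 5) ∞ tubeParam := by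
  have hθ : ∀ i : Fin 3, ContMDiff ((𝓡 2).prod (𝓡 2)) 𝓘(ℝ, ℝ) ∞
      fun p : (𝕊 2) × 𝔼 2 => (p.1 : 𝔼 3) i := fun i =>
    ((EuclideanSpace.proj i).contDiff.comp_contMDiff contMDiff_coe_sphere).comp contMDiff_fst
  have hsnd : ContMDiff ((𝓡 2).prod (𝓡 2)) 𝓘(ℝ, 𝔼 2) ∞ (Prod.snd : (𝕊 2) × 𝔼 2 → 𝔼 2) :=
    contMDiff_snd
  have hw : ∀ j : Fin 2, ContMDiff ((𝓡 2).prod (𝓡 2)) 𝓘(ℝ, ℝ) ∞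
      fun p : (𝕊 2) × 𝔼 2 => p.2 j := fun j =>
    (EuclideanSpace.proj (𝕜 := ℝ) j : 𝔼 2 →L[ℝ] ℝ).contDiff.comp_contMDiff hsnd
  have hc : ContMDiff ((𝓡 2).prod (𝓡 2)) 𝓘(ℝ, ℝ) ∞ fun p : (𝕊 2) × 𝔼 2 => scale p.2 :=
    contDiff_scale.comp_contMDiff hsnd
  refine contMDiff_euclidean_of_coord fun i => ?_
  fin_cases i
  · exact hc.mul (hθ 0)
  · exact hc.mul (hθ 1)
  · exact hc.mul (hθ 2)
  · exact (contMDiff_const.mul hc).mul (hw 0)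
  · exact (contMDiff_const.mul hc).mul (hw 1)

/-- `Π(θ, w)` is a point of the unit sphere of `ℝ⁵`. [folklore] -/
theorem tubeParam_mem_sphere (p : (𝕊 2) × 𝔼 2) : tubeParam p ∈ Metric.sphere (0 : 𝔼 5) 1 := by
  have h := sqNorm_tubeParam p
  rw [sqNorm_eq_norm_sq] at h
  rw [mem_sphere_zero_iff_norm]
  nlinarith [norm_nonneg (tubeParam p)]

/-- `Π` as a map into Mathlib's `𝕊⁴`. [folklore] -/
def tubeParam4 : (𝕊 2) × 𝔼 2 → (𝕊 4) := Set.codRestrict tubeParam _ tubeParam_mem_sphere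

/-- `Π : S² × ℝ² → 𝕊⁴` is smooth (`ContMDiff.codRestrict_sphere`). [folklore] -/
theorem contMDiff_tubeParam4 : ContMDiff ((𝓡 2).prod (𝓡 2)) (𝓡 4) ∞ tubeParam4 :=
  contMDiff_tubeParam.codRestrict_sphere tubeParam_mem_sphere

/-- **`Π` as a map into the level sphere `S`** (through `S ≅ 𝕊⁴`). [folklore] -/
def tubeParamS (p : (𝕊 2) × 𝔼 2) : LevelSphere := sphereLevelDiffeomorph.symm (tubeParam4 p)

/-- `Π : S² × ℝ² → S` is smooth. [folklore] -/
theorem contMDiff_tubeParamS : ContMDiff ((𝓡 2).prod (𝓡 2)) (𝓡 4) ∞ tubeParamS :=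
  sphereLevelDiffeomorph.symm.contMDiff.comp contMDiff_tubeParam4

/-- `ι (Π_S p) = Π p`. [folklore] -/
@[simp] theorem ι_tubeParamS (p : (𝕊 2) × 𝔼 2) : ι (tubeParamS p) = tubeParam p := by
  have h := coe_sphereLevelDiffeomorph (sphereLevelDiffeomorph.symm (tubeParam4 p))
  rw [Diffeomorph.apply_symm_apply] at h
  rw [tubeParamS, ← h]
  rfl

/-- `u(Π_S p) = 2 c² |w|²`. [folklore] -/
theorem tubeS_tubeParamS (p : (𝕊 2) × 𝔼 2) : tubeS (tubeParamS p) = 2 * scale p.2 ^ 2 * sq2 p.2 := by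
  rw [tubeS, ι_tubeParamS, tubeFn_tubeParam]


/-! ### §2 The inverse parametrisation on the equatorial tube -/

/-- The inclusion `W₀ → S` of the equatorial tube into the level sphere. [folklore] -/
abbrev ιW : EquatorTube → LevelSphere := RegularSublevel.incl isRegularLevel_tubeS

/-- On the equatorial tube `u ≤ 1/2`. [folklore] -/
theorem tubeS_ιW_le (q : EquatorTube) : tubeS (ιW q) ≤ 1 / 2 :=
  RegularSublevel.apply_incl_le isRegularLevel_tubeS q

/-- On the equatorial tube `1 - u > 0`. [folklore] -/
theorem one_sub_tubeS_ιW_pos (q : EquatorTube) : 0 < 1 - tubeS (ιW q) := by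
  have h := tubeS_ιW_le q
  linarith

/-- `u = x₃² + x₄²` in coordinates. [folklore] -/
theorem tubeS_eq_coord (y : LevelSphere) : tubeS y = ι y 3 ^ 2 + ι y 4 ^ 2 := rfl

/-- On the level sphere `x₀² + x₁² + x₂² = 1 - u`. [folklore] -/
theorem head_sq_eq (y : LevelSphere) : ι y 0 ^ 2 + ι y 1 ^ 2 + ι y 2 ^ 2 = 1 - tubeS y := by
  have h := sqNorm_ι y
  simp only [sqNorm] at h
  rw [tubeS_eq_coord]
  linarith

/-- **The radial factor** `r = √(1 - u)` on the equatorial tube (the norm of the head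
`(x₀, x₁, x₂)` of a point `x ∈ W₀ ⊆ ℝ⁵`). [folklore] -/
def rad (q : EquatorTube) : ℝ := √(1 - tubeS (ιW q))

/-- `r > 0` on `W₀`. [folklore] -/
theorem rad_pos (q : EquatorTube) : 0 < rad q := Real.sqrt_pos.2 (one_sub_tubeS_ιW_pos q)

/-- `r² = 1 - u`. [folklore] -/
theorem rad_sq (q : EquatorTube) : rad q ^ 2 = 1 - tubeS (ιW q) :=
  Real.sq_sqrt (one_sub_tubeS_ιW_pos q).le

/-- `W₀ → ℝ⁵` is smooth. [folklore] -/
theorem contMDiff_ι_ιW : ContMDiff (𝓡∂ 4) 𝓘(ℝ, 𝔼 5) ∞ fun q : EquatorTube => ι (ιW q) :=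
  (RegularLevel.contMDiff_incl isRegularLevel_sqNorm).comp
    (RegularSublevel.contMDiff_incl isRegularLevel_tubeS)

/-- The ambient coordinates are smooth functions on `W₀`. [folklore] -/
theorem contMDiff_coord_ιW (i : Fin 5) :
    ContMDiff (𝓡∂ 4) 𝓘(ℝ, ℝ) ∞ fun q : EquatorTube => ι (ιW q) i :=
  (EuclideanSpace.proj i).contDiff.comp_contMDiff contMDiff_ι_ιW

/-- `r` is smooth on `W₀` (as `1 - u > 0` there). [folklore] -/
theorem contMDiff_rad : ContMDiff (𝓡∂ 4) 𝓘(ℝ, ℝ) ∞ rad := by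
  have hg : ContMDiff (𝓡∂ 4) 𝓘(ℝ, ℝ) ∞ fun q : EquatorTube => 1 - tubeS (ιW q) :=
    contMDiff_const.sub (contMDiff_tubeS.comp (RegularSublevel.contMDiff_incl isRegularLevel_tubeS))
  intro q
  have h : ContMDiffAt (𝓡∂ 4) 𝓘(ℝ, ℝ) ∞ ((fun t : ℝ => √t) ∘ fun q : EquatorTube => 1 - tubeS (ιW q)) q :=
    ContDiffAt.comp_contMDiffAt (f := fun q : EquatorTube => 1 - tubeS (ιW q)) (x := q)
      (Real.contDiffAt_sqrt (one_sub_tubeS_ιW_pos q).ne') (hg q)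
  exact h

/-- `1/r` is smooth on `W₀`. [folklore] -/
theorem contMDiff_rad_inv : ContMDiff (𝓡∂ 4) 𝓘(ℝ, ℝ) ∞ fun q : EquatorTube => (rad q)⁻¹ :=
  fun q => (contDiffAt_inv ℝ (rad_pos q).ne').comp_contMDiffAt (contMDiff_rad q)

/-- **The inverse head** `θ(x) = (x₀, x₁, x₂)/r ∈ ℝ³` of a point of `W₀`. [folklore] -/
def invHeadVec (q : EquatorTube) : 𝔼 3 :=
  (EuclideanSpace.equiv (Fin 3) ℝ).symm
    ![(rad q)⁻¹ * ι (ιW q) 0, (rad q)⁻¹ * ι (ιW q) 1, (rad q)⁻¹ * ι (ιW q) 2]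

/-- Coordinates of `θ(x)`. [folklore] -/
@[simp] theorem invHeadVec_apply_zero (q : EquatorTube) : invHeadVec q 0 = (rad q)⁻¹ * ι (ιW q) 0 := rfl
/-- Coordinates of `θ(x)`. [folklore] -/
@[simp] theorem invHeadVec_apply_one (q : EquatorTube) : invHeadVec q 1 = (rad q)⁻¹ * ι (ιW q) 1 := rfl
/-- Coordinates of `θ(x)`. [folklore] -/
@[simp] theorem invHeadVec_apply_two (q : EquatorTube) : invHeadVec q 2 = (rad q)⁻¹ * ι (ιW q) 2 := rfl

/-- `|θ(x)| = 1`. [folklore] -/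
theorem norm_invHeadVec (q : EquatorTube) : ‖invHeadVec q‖ = 1 := by
  have hr := rad_pos q
  have hr0 : rad q ≠ 0 := hr.ne'
  have hh := head_sq_eq (ιW q)
  have hrs := rad_sq q
  have h2 : ‖invHeadVec q‖ ^ 2 = 1 := by
    rw [EuclideanSpace.norm_sq_eq, Fin.sum_univ_three]
    simp only [Real.norm_eq_abs, sq_abs, invHeadVec_apply_zero, invHeadVec_apply_one,
      invHeadVec_apply_two, mul_pow]
    have key : (rad q)⁻¹ ^ 2 * rad q ^ 2 = 1 := by
      rw [inv_pow, inv_mul_cancel₀ (pow_ne_zero 2 hr0)]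
    linear_combination key + (rad q)⁻¹ ^ 2 * (hh - hrs)
  exact (pow_eq_one_iff_of_nonneg (norm_nonneg _) two_ne_zero).1 h2

/-- `θ(x) ∈ S²`. [folklore] -/
theorem invHeadVec_mem_sphere (q : EquatorTube) : invHeadVec q ∈ Metric.sphere (0 : 𝔼 3) 1 := by
  rw [mem_sphere_zero_iff_norm]
  exact norm_invHeadVec q

/-- **The inverse head** `θ : W₀ → S²`. [folklore] -/
def invHead : EquatorTube → (𝕊 2) := Set.codRestrict invHeadVec _ invHeadVec_mem_sphere

/-- `θ(x)` as a vector. [folklore] -/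
@[simp] theorem coe_invHead (q : EquatorTube) : ((invHead q : 𝕊 2) : 𝔼 3) = invHeadVec q := rfl

/-- `x ↦ θ(x) ∈ ℝ³` is smooth on `W₀`. [folklore] -/
theorem contMDiff_invHeadVec : ContMDiff (𝓡∂ 4) 𝓘(ℝ, 𝔼 3) ∞ invHeadVec := by
  refine contMDiff_euclidean_of_coord fun i => ?_
  fin_cases i
  · exact contMDiff_rad_inv.mul (contMDiff_coord_ιW 0)
  · exact contMDiff_rad_inv.mul (contMDiff_coord_ιW 1)
  · exact contMDiff_rad_inv.mul (contMDiff_coord_ιW 2)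

/-- `θ : W₀ → S²` is smooth (`ContMDiff.codRestrict_sphere`). [folklore] -/
theorem contMDiff_invHead : ContMDiff (𝓡∂ 4) (𝓡 2) ∞ invHead :=
  contMDiff_invHeadVec.codRestrict_sphere invHeadVec_mem_sphere

/-- **The inverse tail** `w(x) = (x₃, x₄)/(√2 r) ∈ ℝ²` of a point of `W₀`. [folklore] -/
def invTail (q : EquatorTube) : 𝔼 2 :=
  (EuclideanSpace.equiv (Fin 2) ℝ).symm ![(√2 * rad q)⁻¹ * ι (ιW q) 3, (√2 * rad q)⁻¹ * ι (ιW q) 4]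

/-- Coordinates of `w(x)`. [folklore] -/
@[simp] theorem invTail_apply_zero (q : EquatorTube) : invTail q 0 = (√2 * rad q)⁻¹ * ι (ιW q) 3 := rfl
/-- Coordinates of `w(x)`. [folklore] -/
@[simp] theorem invTail_apply_one (q : EquatorTube) : invTail q 1 = (√2 * rad q)⁻¹ * ι (ιW q) 4 := rfl

/-- `x ↦ w(x)` is smooth on `W₀`. [folklore] -/
theorem contMDiff_invTail : ContMDiff (𝓡∂ 4) 𝓘(ℝ, 𝔼 2) ∞ invTail := by
  have hc : ContMDiff (𝓡∂ 4) 𝓘(ℝ, ℝ) ∞ fun q : EquatorTube => (√2 * rad q)⁻¹ := by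
    have h : (fun q : EquatorTube => (√2 * rad q)⁻¹) = fun q => (√2)⁻¹ * (rad q)⁻¹ :=
      funext fun q => mul_inv _ _
    rw [h]
    exact contMDiff_const.mul contMDiff_rad_inv
  refine contMDiff_euclidean_of_coord fun i => ?_
  fin_cases i
  · exact hc.mul (contMDiff_coord_ιW 3)
  · exact hc.mul (contMDiff_coord_ιW 4)

/-- **The inverse parametrisation** `x ↦ (θ(x), w(x)) : W₀ → S² × ℝ²`. [folklore] -/
def invParam (q : EquatorTube) : (𝕊 2) × 𝔼 2 := (invHead q, invTail q)

/-- The inverse parametrisation is smooth. [folklore] -/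
theorem contMDiff_invParam : ContMDiff (𝓡∂ 4) ((𝓡 2).prod (𝓡 2)) ∞ invParam :=
  contMDiff_invHead.prodMk contMDiff_invTail

/-- `|w(x)|² · 2r² = u`. [folklore] -/
theorem sq2_invTail_mul (q : EquatorTube) : sq2 (invTail q) * (2 * rad q ^ 2) = tubeS (ιW q) := by
  have h2 : (√2 : ℝ) ^ 2 = 2 := Real.sq_sqrt zero_le_two
  have hr : rad q ≠ 0 := (rad_pos q).ne'
  have key : (√2 * rad q)⁻¹ ^ 2 * (2 * rad q ^ 2) = 1 := by
    rw [inv_pow, mul_pow, h2, inv_mul_cancel₀ (mul_ne_zero two_ne_zero (pow_ne_zero 2 hr))]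
  simp only [sq2, invTail_apply_zero, invTail_apply_one, tubeS_eq_coord]
  linear_combination (ι (ιW q) 3 ^ 2 + ι (ιW q) 4 ^ 2) * key

/-- `1 + 2|w(x)|² = 1/r²`. [folklore] -/
theorem one_add_two_mul_sq2_invTail (q : EquatorTube) : 1 + 2 * sq2 (invTail q) = (rad q ^ 2)⁻¹ := by
  apply eq_inv_of_mul_eq_one_left
  linear_combination sq2_invTail_mul q + rad_sq q

/-- **The scale factor of the inverse tail is the radial factor**: `c(w(x)) = r`. [folklore] -/
theorem scale_invTail (q : EquatorTube) : scale (invTail q) = rad q := by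
  rw [scale, one_add_two_mul_sq2_invTail, Real.sqrt_inv, inv_inv, Real.sqrt_sq (rad_pos q).le]

/-- On `W₀`, `|w(x)|² ≤ 1/2`. [folklore] -/
theorem sq2_invTail_le (q : EquatorTube) : sq2 (invTail q) ≤ 1 / 2 := by
  have hA := sq2_invTail_mul q
  have hB := rad_sq q
  have hu := tubeS_ιW_le q
  have hr := rad_pos q
  refine le_of_not_gt fun hlt => ?_
  have h1 : (1 / 2) * (2 * rad q ^ 2) < sq2 (invTail q) * (2 * rad q ^ 2) :=
    mul_lt_mul_of_pos_right hlt (by positivity)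
  rw [hA] at h1
  nlinarith [hB, hu, h1]

/-- **`Π ∘ (θ, w) = id` on `W₀`** (in `ℝ⁵`). [folklore] -/
theorem tubeParam_invParam (q : EquatorTube) : tubeParam (invParam q) = ι (ιW q) := by
  have hr : rad q ≠ 0 := (rad_pos q).ne'
  have h2r : √2 * rad q ≠ 0 := mul_ne_zero (Real.sqrt_ne_zero'.2 two_pos) hr
  have hs : scale (invParam q).2 = rad q := scale_invTail q
  have e0 : tubeParam (invParam q) 0 = ι (ιW q) 0 := by
    rw [tubeParam_apply_zero, hs]
    show rad q * invHeadVec q 0 = _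
    rw [invHeadVec_apply_zero, mul_inv_cancel_left₀ hr]
  have e1 : tubeParam (invParam q) 1 = ι (ιW q) 1 := by
    rw [tubeParam_apply_one, hs]
    show rad q * invHeadVec q 1 = _
    rw [invHeadVec_apply_one, mul_inv_cancel_left₀ hr]
  have e2 : tubeParam (invParam q) 2 = ι (ιW q) 2 := by
    rw [tubeParam_apply_two, hs]
    show rad q * invHeadVec q 2 = _
    rw [invHeadVec_apply_two, mul_inv_cancel_left₀ hr]
  have e3 : tubeParam (invParam q) 3 = ι (ιW q) 3 := by
    rw [tubeParam_apply_three, hs]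
    show √2 * rad q * invTail q 0 = _
    rw [invTail_apply_zero, mul_inv_cancel_left₀ h2r]
  have e4 : tubeParam (invParam q) 4 = ι (ιW q) 4 := by
    rw [tubeParam_apply_four, hs]
    show √2 * rad q * invTail q 1 = _
    rw [invTail_apply_one, mul_inv_cancel_left₀ h2r]
  ext i
  fin_cases i
  exacts [e0, e1, e2, e3, e4]

/-- **`Π_S ∘ (θ, w) = id` on `W₀`** (in the level sphere). [folklore] -/
theorem tubeParamS_invParam (q : EquatorTube) : tubeParamS (invParam q) = ιW q :=
  (RegularLevel.isEmbedding_incl isRegularLevel_sqNorm).injective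
    (show ι (tubeParamS (invParam q)) = ι (ιW q) by rw [ι_tubeParamS, tubeParam_invParam])

/-- Along `Π_S`, the radial factor is the scale factor: `r(Π(θ, w)) = c(w)`. [folklore] -/
theorem rad_mk_tubeParamS (p : (𝕊 2) × 𝔼 2) (h : tubeS (tubeParamS p) ≤ 1 / 2) :
    rad (RegularSublevel.mk isRegularLevel_tubeS (tubeParamS p) h) = scale p.2 := by
  show √(1 - tubeFn (ι (tubeParamS p))) = scale p.2
  rw [ι_tubeParamS, one_sub_tubeFn_tubeParam, Real.sqrt_sq (scale_pos p.2).le]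

/-- **`(θ, w) ∘ Π_S = id` on `S² × {|w|² ≤ 1/2}`.** [folklore] -/
theorem invParam_mk_tubeParamS (p : (𝕊 2) × 𝔼 2) (h : tubeS (tubeParamS p) ≤ 1 / 2) :
    invParam (RegularSublevel.mk isRegularLevel_tubeS (tubeParamS p) h) = p := by
  set q := RegularSublevel.mk isRegularLevel_tubeS (tubeParamS p) h with hq
  have hr : rad q = scale p.2 := rad_mk_tubeParamS p h
  have hx : ι (ιW q) = tubeParam p := ι_tubeParamS p
  have hc : scale p.2 ≠ 0 := (scale_pos p.2).ne'
  have h2c : √2 * scale p.2 ≠ 0 := mul_ne_zero (Real.sqrt_ne_zero'.2 two_pos) hc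
  have a0 : invHeadVec q 0 = (p.1 : 𝔼 3) 0 := by
    rw [invHeadVec_apply_zero, hr, hx, tubeParam_apply_zero, inv_mul_cancel_left₀ hc]
  have a1 : invHeadVec q 1 = (p.1 : 𝔼 3) 1 := by
    rw [invHeadVec_apply_one, hr, hx, tubeParam_apply_one, inv_mul_cancel_left₀ hc]
  have a2 : invHeadVec q 2 = (p.1 : 𝔼 3) 2 := by
    rw [invHeadVec_apply_two, hr, hx, tubeParam_apply_two, inv_mul_cancel_left₀ hc]
  have b0 : invTail q 0 = p.2 0 := by
    rw [invTail_apply_zero, hr, hx, tubeParam_apply_three, inv_mul_cancel_left₀ h2c]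
  have b1 : invTail q 1 = p.2 1 := by
    rw [invTail_apply_one, hr, hx, tubeParam_apply_four, inv_mul_cancel_left₀ h2c]
  refine Prod.ext (Subtype.ext ?_) ?_
  · show invHeadVec q = (p.1 : 𝔼 3)
    ext i
    fin_cases i
    exacts [a0, a1, a2]
  · show invTail q = p.2
    ext i
    fin_cases i
    exacts [b0, b1]

end SphereFourSplitting

/-! ### §3 The sphere-side tube of a genus-one fibration is the equatorial tube -/

namespace SphereSideTube

open SphereFourSplitting

variable {X : Type} {f : X → 𝕊 2} {v : 𝕊 2} {ιX : (𝕊 2) × 𝔼 2 → X}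

/-- Mathlib's radial diffeomorphism `univBall 0 2 : ℝ² → D̊²₂` is `w ↦ 2w/√(1 + |w|²)`. [folklore] -/
theorem univBall_zero_two_eq_smul (w : 𝔼 2) :
    OpenPartialHomeomorph.univBall (0 : 𝔼 2) 2 w = (2 * (√(1 + ‖w‖ ^ 2))⁻¹) • w := by
  rw [OpenPartialHomeomorph.univBall, dif_pos two_pos, OpenPartialHomeomorph.trans'_apply,
    OpenPartialHomeomorph.unitBallBall_apply, OpenPartialHomeomorph.univUnitBall_apply, smul_smul,
    vadd_eq_add, add_zero]

/-- `|univBall 0 2 w|² = 4|w|²/(1 + |w|²)`. [folklore] -/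
theorem norm_univBall_zero_two_sq (w : 𝔼 2) :
    ‖OpenPartialHomeomorph.univBall (0 : 𝔼 2) 2 w‖ ^ 2 = 4 * sq2 w / (1 + sq2 w) := by
  rw [univBall_zero_two_eq_smul]
  simp only [norm_smul, mul_pow, inv_pow, Real.norm_eq_abs, sq_abs]
  rw [Real.sq_sqrt (by positivity), ← sq2_eq_norm_sq]
  ring

/-- A rational identity. [folklore] -/
theorem height_aux {s : ℝ} (hs : 0 ≤ s) :
    (4 * s / (1 + s) - 4) / (4 * s / (1 + s) + 4) = -(1 + 2 * s)⁻¹ := by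
  have h1 : (1 + s) ≠ 0 := by positivity
  have h2 : (1 + 2 * s) ≠ 0 := by positivity
  have hA : 4 * s / (1 + s) - 4 = -4 / (1 + s) := by
    field_simp
    ring
  have hB : 4 * s / (1 + s) + 4 = (8 * s + 4) / (1 + s) := by
    field_simp
    ring
  have h3 : (8 * s + 4) ≠ 0 := by positivity
  rw [hA, hB, div_div_div_cancel_right₀ h1, neg_div, inv_eq_one_div, neg_inj,
    div_eq_div_iff h3 h2]
  ring

/-- **The height of the parametrised hemisphere**: `⟪v, σᵥ⁻¹(univBall 0 2 w)⟫ = -1/(1 + 2|w|²)`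
(from `inner_stereographic'_symm`: `⟪σᵥ⁻¹ z, v⟫ = (|z|² - 4)/(|z|² + 4)`). [folklore] -/
theorem height_stereographic'_symm_univBall (v : 𝕊 2) (w : 𝔼 2) :
    SphereHeight.height (v : 𝔼 3)
        ((stereographic' 2 v).symm (OpenPartialHomeomorph.univBall (0 : 𝔼 2) 2 w)) =
      -(1 + 2 * sq2 w)⁻¹ := by
  rw [SphereHeight.height_apply, real_inner_comm, inner_stereographic'_symm,
    norm_univBall_zero_two_sq]
  exact height_aux (sq2_nonneg w)

/-- **The height along the product structure of the sphere side**: if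
`f (ι(θ, w)) = σᵥ⁻¹(univBall 0 2 w)` then `⟪v, f (ι(θ, w))⟫ = -1/(1 + 2|w|²)`. [folklore] -/
theorem height_ιX
    (hιf : ∀ p, f (ιX p) = (stereographic' 2 v).symm (OpenPartialHomeomorph.univBall (0 : 𝔼 2) 2 p.2))
    (p : (𝕊 2) × 𝔼 2) : (SphereHeight.height (v : 𝔼 3) ∘ f) (ιX p) = -(1 + 2 * sq2 p.2)⁻¹ := by
  rw [comp_apply, hιf, height_stereographic'_symm_univBall]

/-- `⟪v, f (ι(θ, w))⟫ ≤ -1/2 ↔ |w|² ≤ 1/2`. [folklore] -/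
theorem height_ιX_le_iff
    (hιf : ∀ p, f (ιX p) = (stereographic' 2 v).symm (OpenPartialHomeomorph.univBall (0 : 𝔼 2) 2 p.2))
    (p : (𝕊 2) × 𝔼 2) :
    (SphereHeight.height (v : 𝔼 3) ∘ f) (ιX p) ≤ -1 / 2 ↔ sq2 p.2 ≤ 1 / 2 := by
  rw [height_ιX hιf]
  have hs := sq2_nonneg p.2
  have hD : 0 < 1 + 2 * sq2 p.2 := by linarith
  rw [show (-1 / 2 : ℝ) = -(2⁻¹) by norm_num, neg_le_neg_iff, inv_le_inv₀ two_pos hD]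
  constructor
  · intro h; linarith
  · intro h; linarith

/-- Points of negative height lie in the sphere side `ι(S² × ℝ²) = f⁻¹{⟪·, v⟫ < 0}`. [folklore] -/
theorem mem_range_ιX (hrange : range ιX = f ⁻¹' {y | ⟪(y : 𝔼 3), (v : 𝔼 3)⟫ < 0}) {x : X}
    (hx : (SphereHeight.height (v : 𝔼 3) ∘ f) x < 0) : x ∈ range ιX := by
  rw [hrange, mem_preimage, mem_setOf_eq, real_inner_comm]
  exact hx

variable [TopologicalSpace X] [ChartedSpace (𝔼 4) X] [IsManifold (𝓡 4) ∞ X]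

omit [IsManifold (𝓡 4) ∞ X] in
/-- Points of the closed sphere-side tube `B = {⟪v, f⟫ ≤ -1/2}` lie in the sphere side. [folklore] -/
theorem incl_mem_range_ιX (hrange : range ιX = f ⁻¹' {y | ⟪(y : 𝔼 3), (v : 𝔼 3)⟫ < 0})
    (hg : IsRegularLevel (𝓡 4) (SphereHeight.height (v : 𝔼 3) ∘ f) (-1 / 2))
    (b : RegularSublevel hg) : RegularSublevel.incl hg b ∈ range ιX :=
  mem_range_ιX hrange (by have h := RegularSublevel.apply_incl_le hg b; linarith)

omit [IsManifold (𝓡 4) ∞ X] in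
/-- `ι (ι⁻¹ x) = x` on the closed sphere-side tube. [folklore] -/
theorem apply_invFun_incl (hrange : range ιX = f ⁻¹' {y | ⟪(y : 𝔼 3), (v : 𝔼 3)⟫ < 0})
    (hg : IsRegularLevel (𝓡 4) (SphereHeight.height (v : 𝔼 3) ∘ f) (-1 / 2))
    (b : RegularSublevel hg) : ιX (invFun ιX (RegularSublevel.incl hg b)) = RegularSublevel.incl hg b :=
  invFun_eq (incl_mem_range_ιX hrange hg b)

omit [IsManifold (𝓡 4) ∞ X] in
/-- The forward map lands in `W₀`: `u(Π(ι⁻¹ x)) ≤ 1/2` for `x ∈ B`. [folklore] -/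
theorem tubeS_tubeParamS_invFun_le (hrange : range ιX = f ⁻¹' {y | ⟪(y : 𝔼 3), (v : 𝔼 3)⟫ < 0})
    (hιf : ∀ p, f (ιX p) = (stereographic' 2 v).symm (OpenPartialHomeomorph.univBall (0 : 𝔼 2) 2 p.2))
    (hg : IsRegularLevel (𝓡 4) (SphereHeight.height (v : 𝔼 3) ∘ f) (-1 / 2))
    (b : RegularSublevel hg) :
    tubeS (tubeParamS (invFun ιX (RegularSublevel.incl hg b))) ≤ 1 / 2 := by
  have hle : (SphereHeight.height (v : 𝔼 3) ∘ f) (RegularSublevel.incl hg b) ≤ -1 / 2 :=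
    RegularSublevel.apply_incl_le hg b
  rw [← apply_invFun_incl hrange hg b, height_ιX_le_iff hιf] at hle
  show tubeFn (ι (tubeParamS _)) ≤ 1 / 2
  rw [ι_tubeParamS, tubeFn_tubeParam_le_half_iff]
  exact hle

/-- **The forward map `B → W₀`, `x = ι(θ, w) ↦ Π_S(θ, w)`.** [folklore] -/
def toTube (hrange : range ιX = f ⁻¹' {y | ⟪(y : 𝔼 3), (v : 𝔼 3)⟫ < 0})
    (hιf : ∀ p, f (ιX p) = (stereographic' 2 v).symm (OpenPartialHomeomorph.univBall (0 : 𝔼 2) 2 p.2))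
    (hg : IsRegularLevel (𝓡 4) (SphereHeight.height (v : 𝔼 3) ∘ f) (-1 / 2)) :
    RegularSublevel hg → EquatorTube :=
  Set.codRestrict (fun b => tubeParamS (invFun ιX (RegularSublevel.incl hg b))) _
    fun b => show tubeS _ ≤ 1 / 2 from tubeS_tubeParamS_invFun_le hrange hιf hg b

/-- The forward map `B → W₀` is smooth (`ι⁻¹` is smooth on `range ι`,
`Literature.Geometry.Manifold.contMDiffOn_invFun_range`; `Π_S` is smooth; smoothness into the
regular domain `W₀`, Lee 2013, Cor. 5.30). [cite: LeeSmoothManifolds2013, Cor. 5.30 and Prop. 4.22] -/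
theorem contMDiff_toTube (hemb : Manifold.IsSmoothEmbedding ((𝓡 2).prod (𝓡 2)) (𝓡 4) ∞ ιX)
    (hrange : range ιX = f ⁻¹' {y | ⟪(y : 𝔼 3), (v : 𝔼 3)⟫ < 0})
    (hιf : ∀ p, f (ιX p) = (stereographic' 2 v).symm (OpenPartialHomeomorph.univBall (0 : 𝔼 2) 2 p.2))
    (hg : IsRegularLevel (𝓡 4) (SphereHeight.height (v : 𝔼 3) ∘ f) (-1 / 2)) :
    ContMDiff (𝓡∂ 4) (𝓡∂ 4) ∞ (toTube hrange hιf hg) := by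
  haveI : Nonempty ((𝕊 2) × 𝔼 2) := ⟨(v, 0)⟩
  have h1 : ContMDiff (𝓡∂ 4) ((𝓡 2).prod (𝓡 2)) ∞
      fun b : RegularSublevel hg => invFun ιX (RegularSublevel.incl hg b) :=
    (Literature.Geometry.Manifold.contMDiffOn_invFun_range hemb).comp_contMDiff
      (RegularSublevel.contMDiff_incl hg) (incl_mem_range_ιX hrange hg)
  exact (RegularSublevel.halfSliceAtlas isRegularLevel_tubeS).contMDiff_codRestrict _
    (contMDiff_tubeParamS.comp h1)

/-- **The backward map `W₀ → B`, `x ↦ ι(θ(x), w(x))`.** [folklore] -/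
def ofTube
    (hιf : ∀ p, f (ιX p) = (stereographic' 2 v).symm (OpenPartialHomeomorph.univBall (0 : 𝔼 2) 2 p.2))
    (hg : IsRegularLevel (𝓡 4) (SphereHeight.height (v : 𝔼 3) ∘ f) (-1 / 2)) :
    EquatorTube → RegularSublevel hg :=
  Set.codRestrict (fun q => ιX (invParam q)) _ fun q =>
    show (SphereHeight.height (v : 𝔼 3) ∘ f) (ιX (invParam q)) ≤ -1 / 2 from
      (height_ιX_le_iff hιf _).2 (sq2_invTail_le q)

omit [IsManifold (𝓡 4) ∞ X] in
/-- The backward map is the stated map on points. [folklore] -/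
@[simp] theorem incl_ofTube
    (hιf : ∀ p, f (ιX p) = (stereographic' 2 v).symm (OpenPartialHomeomorph.univBall (0 : 𝔼 2) 2 p.2))
    (hg : IsRegularLevel (𝓡 4) (SphereHeight.height (v : 𝔼 3) ∘ f) (-1 / 2)) (q : EquatorTube) :
    RegularSublevel.incl hg (ofTube hιf hg q) = ιX (invParam q) := rfl

/-- The backward map `W₀ → B` is smooth (Lee 2013, Cor. 5.30). [cite: LeeSmoothManifolds2013, Cor. 5.30] -/
theorem contMDiff_ofTube (hemb : Manifold.IsSmoothEmbedding ((𝓡 2).prod (𝓡 2)) (𝓡 4) ∞ ιX)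
    (hιf : ∀ p, f (ιX p) = (stereographic' 2 v).symm (OpenPartialHomeomorph.univBall (0 : 𝔼 2) 2 p.2))
    (hg : IsRegularLevel (𝓡 4) (SphereHeight.height (v : 𝔼 3) ∘ f) (-1 / 2)) :
    ContMDiff (𝓡∂ 4) (𝓡∂ 4) ∞ (ofTube hιf hg) :=
  (RegularSublevel.halfSliceAtlas hg).contMDiff_codRestrict _
    (hemb.contMDiff.comp contMDiff_invParam)

omit [IsManifold (𝓡 4) ∞ X] in
/-- `W₀ → B → W₀` is the identity. [folklore] -/
theorem toTube_ofTube (hemb : Manifold.IsSmoothEmbedding ((𝓡 2).prod (𝓡 2)) (𝓡 4) ∞ ιX)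
    (hrange : range ιX = f ⁻¹' {y | ⟪(y : 𝔼 3), (v : 𝔼 3)⟫ < 0})
    (hιf : ∀ p, f (ιX p) = (stereographic' 2 v).symm (OpenPartialHomeomorph.univBall (0 : 𝔼 2) 2 p.2))
    (hg : IsRegularLevel (𝓡 4) (SphereHeight.height (v : 𝔼 3) ∘ f) (-1 / 2)) (q : EquatorTube) :
    toTube hrange hιf hg (ofTube hιf hg q) = q := by
  apply RegularSublevel.injective_incl isRegularLevel_tubeS
  show tubeParamS (invFun ιX (ιX (invParam q))) = ιW q
  rw [leftInverse_invFun hemb.isEmbedding.injective]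
  exact tubeParamS_invParam q

omit [IsManifold (𝓡 4) ∞ X] in
/-- `B → W₀ → B` is the identity. [folklore] -/
theorem ofTube_toTube (hrange : range ιX = f ⁻¹' {y | ⟪(y : 𝔼 3), (v : 𝔼 3)⟫ < 0})
    (hιf : ∀ p, f (ιX p) = (stereographic' 2 v).symm (OpenPartialHomeomorph.univBall (0 : 𝔼 2) 2 p.2))
    (hg : IsRegularLevel (𝓡 4) (SphereHeight.height (v : 𝔼 3) ∘ f) (-1 / 2))
    (b : RegularSublevel hg) : ofTube hιf hg (toTube hrange hιf hg b) = b := by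
  apply RegularSublevel.injective_incl hg
  show ιX (invParam (RegularSublevel.mk isRegularLevel_tubeS
    (tubeParamS (invFun ιX (RegularSublevel.incl hg b))) (tubeS_tubeParamS_invFun_le hrange hιf hg b))) =
      RegularSublevel.incl hg b
  rw [invParam_mk_tubeParamS]
  exact apply_invFun_incl hrange hg b

/-- **The closed sphere-side tube is the equatorial tube of the 4-sphere.**  For a smooth map
`f : X → S²` on a `4`-manifold, a pole `v` and a smooth embedding `ι : S² × ℝ² ↪ X` onto
`f⁻¹{⟪·, v⟫ < 0}` with `f (ι(θ, w)) = σᵥ⁻¹(univBall 0 2 w)` (the fibrewise product structure of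
the sphere side of a genus-one SBLF, `exists_pole_isSmoothEmbedding_sphere_two_prod_side`), and
`-1/2` a regular level of the height `⟪v, f⟫`, the closed tube `B = {⟪v, f⟫ ≤ -1/2}` — a compact
`4`-manifold with boundary (`RegularSublevel`) — is diffeomorphic to the equatorial tube
`W₀ = {u ≤ 1/2} ≅ S² × D²` of the level sphere `S ≅ S⁴` (`SphereFourSplitting.EquatorTube`), by
`Π_S(θ, w) ↤ ι(θ, w)`.  Auroux–Donaldson–Katzarkov (2005), §8.2: "`X_+ ≃ S² × D²`";
Baykur–Kamada (2015), §5: the lower side `X_l ≅ S² × D²`.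
[cite: AurouxDonaldsonKatzarkov2005, §8.2 Example 1] [cite: BaykurKamada2015, §2 and §5]
[cite: LeeSmoothManifolds2013, Cor. 5.30] -/
def tubeDiffeomorph (hemb : Manifold.IsSmoothEmbedding ((𝓡 2).prod (𝓡 2)) (𝓡 4) ∞ ιX)
    (hrange : range ιX = f ⁻¹' {y | ⟪(y : 𝔼 3), (v : 𝔼 3)⟫ < 0})
    (hιf : ∀ p, f (ιX p) = (stereographic' 2 v).symm (OpenPartialHomeomorph.univBall (0 : 𝔼 2) 2 p.2))
    (hg : IsRegularLevel (𝓡 4) (SphereHeight.height (v : 𝔼 3) ∘ f) (-1 / 2)) :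
    EquatorTube ≃ₘ⟮𝓡∂ 4, 𝓡∂ 4⟯ RegularSublevel hg where
  toFun := ofTube hιf hg
  invFun := toTube hrange hιf hg
  left_inv := toTube_ofTube hemb hrange hιf hg
  right_inv := ofTube_toTube hrange hιf hg
  contMDiff_toFun := contMDiff_ofTube hemb hιf hg
  contMDiff_invFun := contMDiff_toTube hemb hrange hιf hg

/-- The diffeomorphism `W₀ ≅ B` on points: `x ↦ ι(θ(x), w(x))`. [folklore] -/
@[simp] theorem incl_tubeDiffeomorph (hemb : Manifold.IsSmoothEmbedding ((𝓡 2).prod (𝓡 2)) (𝓡 4) ∞ ιX)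
    (hrange : range ιX = f ⁻¹' {y | ⟪(y : 𝔼 3), (v : 𝔼 3)⟫ < 0})
    (hιf : ∀ p, f (ιX p) = (stereographic' 2 v).symm (OpenPartialHomeomorph.univBall (0 : 𝔼 2) 2 p.2))
    (hg : IsRegularLevel (𝓡 4) (SphereHeight.height (v : 𝔼 3) ∘ f) (-1 / 2)) (q : EquatorTube) :
    RegularSublevel.incl hg (tubeDiffeomorph hemb hrange hιf hg q) = ιX (invParam q) := rfl

end SphereSideTube

namespace IsSimplifiedBrokenLefschetzFibration

variable {X : Type} [TopologicalSpace X] [T2Space X] [SecondCountableTopology X] [CompactSpace X]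
  [ChartedSpace (𝔼 4) X] [IsManifold (𝓡 4) ∞ X]
  {o : SmoothOrientation (𝓡 4) X} {f : X → 𝕊 2} {h : ℕ}

omit [T2Space X] [SecondCountableTopology X] [CompactSpace X] in
/-- **The heights `⟪v, f⟫` of a Lefschetz-free SBLF with equatorial round image, `v` a pole, have
every level `a < 0`, `a ≠ -1` regular.**  At a point `x` of such a level `f` is a submersion
(`surjective_mfderiv_of_inner_lt_zero`: the hemisphere `{⟪·, v⟫ < 0}` misses the round image), so
`x` critical for `⟪v, ·⟫ ∘ f` would make `f x` critical for the height `⟪v, ·⟫` on `S²`, i.e.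
`f x = ±v` (`SphereHeight.coe_eq_or_eq_neg_of_isMCriticalPt`, Milnor 1963, §6) and `a = ±1`.
[cite: BaykurKamada2015, §2 (arXiv p. 7)] [cite: Milnor1963, §6] -/
theorem isRegularLevel_height_comp (hf : IsSimplifiedBrokenLefschetzFibration o f ∅ h)
    (hround : f '' ({p : X | ¬ Surjective (mfderiv (𝓡 4) (𝓡 2) f p)} \
      (↑(∅ : Finset X) : Set X)) = sphereEquator 1)
    {v : 𝕊 2} (hv0 : (v : 𝔼 3) 0 = 0) (hv1 : (v : 𝔼 3) 1 = 0) {a : ℝ} (ha : a < 0) (ha1 : a ≠ -1) :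
    IsRegularLevel (𝓡 4) (SphereHeight.height (v : 𝔼 3) ∘ f) a := by
  refine isRegularLevel_of_not_isMCriticalPt ((SphereHeight.contMDiff_height _).comp hf.contMDiff)
    fun x hx hcrit => ?_
  have hxa : ⟪(v : 𝔼 3), ((f x : 𝕊 2) : 𝔼 3)⟫ = a := hx
  have hq : ⟪((f x : 𝕊 2) : 𝔼 3), (v : 𝔼 3)⟫ < 0 := by
    rw [real_inner_comm, hxa]; exact ha
  have hs := hf.surjective_mfderiv_of_inner_lt_zero hround hv0 hv1 hq
  have hfd : MDifferentiableAt (𝓡 4) (𝓡 2) f x := hf.contMDiff.mdifferentiableAt (by simp)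
  have hℓd : MDifferentiableAt (𝓡 2) 𝓘(ℝ, ℝ) (SphereHeight.height (v : 𝔼 3)) (f x) :=
    (SphereHeight.contMDiff_height _).mdifferentiableAt (by simp)
  have hcritS : IsMCriticalPt (𝓡 2) (SphereHeight.height (v : 𝔼 3)) (f x) :=
    (isMCriticalPt_comp_iff_of_surjective_mfderiv hfd hℓd hs).1 hcrit
  have hv : (v : 𝔼 3) ≠ 0 := ne_zero_of_mem_unit_sphere v
  have hn : ‖(v : 𝔼 3)‖ = 1 := norm_eq_of_mem_sphere v
  rcases SphereHeight.coe_eq_or_eq_neg_of_isMCriticalPt hv hcritS with h1 | h1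
  · rw [hn, inv_one, one_smul] at h1
    rw [h1, real_inner_self_eq_norm_sq, hn] at hxa
    norm_num at hxa
    linarith
  · rw [hn, inv_one, one_smul] at h1
    rw [h1, inner_neg_right, real_inner_self_eq_norm_sq, hn] at hxa
    norm_num at hxa
    exact ha1 hxa.symm

/-- **The closed sphere-side tube of a genus-one Lefschetz-free SBLF is `S² × D²` — precisely,
the equatorial tube `W₀` of `S⁴`.**  Let `f : X → S²` be a genus-one simplified broken Lefschetz
fibration without Lefschetz points on a closed `4`-manifold `X : Type`, with equatorial round
image.  Then there are a pole `v = ±e₂` and a smooth embedding `ι : S² × ℝ² ↪ X` onto the sphere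
side `f⁻¹{⟪·, v⟫ < 0}` with `f (ι(θ, w)) = σᵥ⁻¹(univBall 0 2 w)` (the torus side being
`{⟪·, -v⟫ < 0}`, of regular values with `H₁(fibre) ≅ ℤ²`), `-1/2` is a regular level of the
height `⟪v, f⟫`, and the closed sphere-side tube `{⟪v, f⟫ ≤ -1/2}` is diffeomorphic to
`W₀ = SphereFourSplitting.EquatorTube ≅ S² × D²`.  Baykur–Kamada (2015), §2 and §5 (`X_l`, the
lower side, is `S² × D²`); Auroux–Donaldson–Katzarkov (2005), §8.2, Example 1 ("`X_+ ≃ S² × D²`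
lying over the northern hemisphere").
[cite: BaykurKamada2015, §2 and §5] [cite: AurouxDonaldsonKatzarkov2005, §8.2 Example 1] -/
theorem exists_pole_isRegularLevel_nonempty_diffeomorph_equatorTube
    (hf : IsSimplifiedBrokenLefschetzFibration o f ∅ 0)
    (hround : f '' ({p : X | ¬ Surjective (mfderiv (𝓡 4) (𝓡 2) f p)} \
      (↑(∅ : Finset X) : Set X)) = sphereEquator 1) :
    ∃ (v : 𝕊 2) (ιX : (𝕊 2) × 𝔼 2 → X), (v : 𝔼 3) 0 = 0 ∧ (v : 𝔼 3) 1 = 0 ∧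
      Manifold.IsSmoothEmbedding ((𝓡 2).prod (𝓡 2)) (𝓡 4) ∞ ιX ∧
      range ιX = f ⁻¹' {y | ⟪(y : 𝔼 3), (v : 𝔼 3)⟫ < 0} ∧
      (∀ p, f (ιX p) = (stereographic' 2 v).symm (OpenPartialHomeomorph.univBall (0 : 𝔼 2) 2 p.2)) ∧
      (∀ y : 𝕊 2, ⟪(y : 𝔼 3), ((-v : 𝕊 2) : 𝔼 3)⟫ < 0 →
        (∀ q, f q = y → Surjective (mfderiv (𝓡 4) (𝓡 2) f q)) ∧
        Module.finrank ℤ (singularHomology ℤ ℤ ↥(f ⁻¹' {y}) 1) = 2) ∧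
      ∃ hg : IsRegularLevel (𝓡 4) (SphereHeight.height (v : 𝔼 3) ∘ f) (-1 / 2),
        Nonempty (SphereFourSplitting.EquatorTube ≃ₘ⟮𝓡∂ 4, 𝓡∂ 4⟯ RegularSublevel hg) := by
  obtain ⟨v, ιX, hv0, hv1, hemb, hrange, -, -, hιf, hhi⟩ :=
    hf.exists_pole_isSmoothEmbedding_sphere_two_prod_side hround
  have hg : IsRegularLevel (𝓡 4) (SphereHeight.height (v : 𝔼 3) ∘ f) (-1 / 2) :=
    hf.isRegularLevel_height_comp hround hv0 hv1 (by norm_num) (by norm_num)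
  exact ⟨v, ιX, hv0, hv1, hemb, hrange, hιf, hhi, hg,
    ⟨SphereSideTube.tubeDiffeomorph hemb hrange hιf hg⟩⟩

end IsSimplifiedBrokenLefschetzFibration

/-! ### §4 Reduction of the named fact to Laudenbach–Poénaru and the polar handlebody -/

/-- **Baykur–Kamada's Lemma 11 in the simply connected case (with Cor. 14), reduced to
Laudenbach–Poénaru and the handle structure of the complementary tube.**  The named fact
`nonempty_diffeomorph_sphere_four_of_sblf_genus_one_noLefschetz` — a simply connected closed
`4`-manifold carrying a genus-one simplified broken Lefschetz fibration without Lefschetz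
singularities is diffeomorphic to `S⁴` — follows from

* `hLP`, the Laudenbach–Poénaru extension theorem (`exists_diffeomorph_comp_incl_eq`, universe
  `0`), and
* `hK`, the following statement, spelled out as a hypothesis and NOT vendored as a fact: for
  every such fibration `f : X → S²` on a simply connected closed `X : Type` with equatorial round
  image, pole `v` and product structure `ι` of the sphere side as produced by
  `exists_pole_isRegularLevel_nonempty_diffeomorph_equatorTube`, the complementary tube
  `K = {⟪v, f⟫ ≥ -1/2}` (the torus side together with the round cobordism: Baykur–Kamada's
  `W ∪ X_h`, Auroux–Donaldson–Katzarkov's `X_- ∪ W ≃ S¹ × B³` "in the simply connected case") has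
  a handle decomposition with exactly one `0`-handle, one `1`-handle and no other handles.  This
  is the remaining classification content of Baykur–Kamada §5 / ADK §8.2 for `π₁ = 1` (the torus
  side `T² × D²` plus a round `2`-handle is `S¹ × B³` when the vanishing cycle is primitive).

Proof: normalise the round image to the equator (`exists_image_round_eq_sphereEquator`), split
`X = B ∪ K` along the regular level `⟪v, f⟫ = -1/2` (`RegularSublevel.isBoundaryGluing_split`,
Milnor 1963, Thm. 3.1), identify `B ≅ W₀` (§3), and conclude by the four-sphere recognition
`SphereFourSplitting.nonempty_diffeomorph_sphere_four_of_isBoundaryGluing_of_diffeomorph_equatorTube`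
(`W₀ ∪ V ≅ S⁴` for every orientable `(1,1)`-handlebody `V`, modulo Laudenbach–Poénaru).
[cite: BaykurKamada2015, Lemma 11, Thm. 13, Cor. 14 and §5]
[cite: AurouxDonaldsonKatzarkov2005, §8.2 Example 1] [cite: LaudenbachPoenaruBSMF1972, main theorem]
[cite: Milnor1963, Thm. 3.1] -/
theorem nonempty_diffeomorph_sphere_four_of_sblf_genus_one_noLefschetz_of_laudenbachPoenaru_of_polarHandlebody
    (hLP : exists_diffeomorph_comp_incl_eq.{0})
    (hK : ∀ (X : Type) [TopologicalSpace X] [T2Space X] [SecondCountableTopology X] [CompactSpace X]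
        [ChartedSpace (𝔼 4) X] [IsManifold (𝓡 4) ∞ X] [SimplyConnectedSpace X]
        (o : SmoothOrientation (𝓡 4) X) (f : X → 𝕊 2),
        IsSimplifiedBrokenLefschetzFibration o f ∅ 0 →
        f '' ({p : X | ¬ Surjective (mfderiv (𝓡 4) (𝓡 2) f p)} \ (↑(∅ : Finset X) : Set X)) =
          sphereEquator 1 →
        ∀ (v : 𝕊 2) (ιX : (𝕊 2) × 𝔼 2 → X), (v : 𝔼 3) 0 = 0 → (v : 𝔼 3) 1 = 0 →
        Manifold.IsSmoothEmbedding ((𝓡 2).prod (𝓡 2)) (𝓡 4) ∞ ιX →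
        range ιX = f ⁻¹' {y | ⟪(y : 𝔼 3), (v : 𝔼 3)⟫ < 0} →
        (∀ p, f (ιX p) = (stereographic' 2 v).symm (OpenPartialHomeomorph.univBall (0 : 𝔼 2) 2 p.2)) →
        (∀ y : 𝕊 2, ⟪(y : 𝔼 3), ((-v : 𝕊 2) : 𝔼 3)⟫ < 0 →
            (∀ q, f q = y → Surjective (mfderiv (𝓡 4) (𝓡 2) f q)) ∧
            Module.finrank ℤ (singularHomology ℤ ℤ ↥(f ⁻¹' {y}) 1) = 2) →
        ∀ hg : IsRegularLevel (𝓡 4) (SphereHeight.height (v : 𝔼 3) ∘ f) (-1 / 2),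
        HasHandleDecomposition 3 (RegularSuperlevel hg) (handleCount 1 1)) :
    nonempty_diffeomorph_sphere_four_of_sblf_genus_one_noLefschetz := by
  intro X _ _ _ _ _ _ _ hX
  obtain ⟨o, f₀, hf₀⟩ := hX
  obtain ⟨f, hf, hround⟩ := hf₀.exists_image_round_eq_sphereEquator
  obtain ⟨v, ιX, hv0, hv1, hemb, hrange, hιf, hhi, hg, ⟨Ξ⟩⟩ :=
    hf.exists_pole_isRegularLevel_nonempty_diffeomorph_equatorTube hround
  have hKdec : HasHandleDecomposition 3 (RegularSuperlevel hg) (handleCount 1 1) :=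
    hK X o f hf hround v ιX hv0 hv1 hemb hrange hιf hhi hg
  have hoK : IsOrientable (𝓡∂ 4) (RegularSuperlevel hg) :=
    RegularSublevel.isOrientable hg.const_sub ⟨o⟩
  haveI : ConnectedSpace (RegularSuperlevel hg) := hKdec.connectedSpace (handleCount_zero 1 1)
  exact SphereFourSplitting.nonempty_diffeomorph_sphere_four_of_isBoundaryGluing_of_diffeomorph_equatorTube
    hLP Ξ hKdec hoK (RegularSublevel.isBoundaryGluing_split hg)

end Literature.Topology.FourManifolds
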